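import Literature.Geometry.Lorentzian.KerrDeSitterRadialTSRealAxisThreeHalves
import Literature.Geometry.Lorentzian.KerrDeSitterRadialTSRealAxisNegThreeHalves
import HarnessLib

/-!
# Half-integer spin `|s| = 3/2` on the real axis, IX: both signs, one clause

The twin of `FermionicTSCoercive` (`2|s| = 1 ∧ ℭ_{1/2}(λ̄) ≥ 0`,
`KerrDeSitterFermionicRealAxis.lean`) at `|s| = 3/2`: the clause
`FermionicTSCoerciveAbsThreeHalves M a Λ s ω m λ := 2|s| = 3 ∧ Re ℭ_{3/2}(λ̄) ≥ 0`,
`λ̄ = lambdaBar a Λ s ω m λ` (`ℭ_{3/2} = tsRadialConstantThreeHalves`, Wu–Yan's `|C_{3/2}|²`; at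
`s = +3/2` the cubic in the tree's `λ`, at `s = −3/2` the same cubic in `λ + 3(1−α)`,
`tsRadialConstantThreeHalves_lambdaBar(_neg)`), and THE THEOREM
`radial_real_eq_zero_of_fermionicTSCoerciveAbsThreeHalves`: on subextremal Kerr–de Sitter,
`Im ω = 0`, `Im λ̄ = 0` and the clause force every classical radial Teukolsky solution on
`(r₊, r_c)` ingoing at `𝓗⁺` and outgoing at `𝓗⁺_c` to vanish —
`radial_threeHalves_real_eq_zero_of_coercive` (file VI, the `s = 3/2` energy identity) and
`radial_negThreeHalves_real_eq_zero_of_coercive` (file VIII, duality).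
This is CTdC Theorem 3.10's fermionic real-axis clause at `|s| = 3/2` IN ITS DOMAIN OF VALIDITY; for
`Re ℭ_{3/2} < 0` nothing is claimed (cell pub-kds' certified real-frequency `s = 3/2` solutions all
have `Re ℭ_{3/2} < 0`). Definitions with bodies + theorems, NO named facts.

Sources: [CasalsTeixeiradacosta2022] Theorem 3.10 (second bullet); [Costa2019] Proposition 2.21;
[WuYan2004] Appendix A (A4)–(A6).
-/

noncomputable section

open Complex Set

namespace Literature.Geometry.Lorentzian.KerrDeSitter

/-- **The Teukolsky–Starobinsky coercivity clause for the fermionic real-axis case at `|s| = 3/2`**: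
`2|s| = 3` and `Re ℭ_{3/2}(λ̄) ≥ 0` at `λ̄ = lambdaBar a Λ s ω m λ` — the twin of
`FermionicTSCoercive` (`|s| = 1/2`). [cite: Costa2019, Proposition 2.21] -/
def FermionicTSCoerciveAbsThreeHalves (M a Λ s : ℝ) (ω : ℂ) (m : ℝ) (lam : ℂ) : Prop :=
  2 * |s| = 3 ∧ 0 ≤ (tsRadialConstantThreeHalves M a Λ ω m (lambdaBar a Λ s ω m lam)).re

/-- The clause at `|s| = 3/2` is the disjunction of the two signed clauses of files VI and VIII.
[cite: Costa2019, Proposition 2.21] -/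
theorem fermionicTSCoerciveAbsThreeHalves_iff (M a Λ s : ℝ) (ω : ℂ) (m : ℝ) (lam : ℂ) :
    FermionicTSCoerciveAbsThreeHalves M a Λ s ω m lam ↔
      FermionicTSCoerciveThreeHalves M a Λ s ω m lam ∨
        FermionicTSCoerciveNegThreeHalves M a Λ s ω m lam := by
  constructor
  · rintro ⟨hs, hc⟩
    have hs' : |s| = 3 / 2 := by linarith
    rcases (abs_eq (by norm_num : (0 : ℝ) ≤ 3 / 2)).1 hs' with rfl | rfl
    · exact Or.inl ⟨rfl, hc⟩
    · exact Or.inr ⟨rfl, hc⟩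
  · rintro (⟨rfl, hc⟩ | ⟨rfl, hc⟩)
    · exact ⟨by rw [abs_of_pos (by norm_num : (0 : ℝ) < 3 / 2)]; norm_num, hc⟩
    · exact ⟨by rw [abs_of_neg (by norm_num : (-(3 / 2) : ℝ) < 0)]; norm_num, hc⟩

/-- **CTdC Theorem 3.10, fermionic real-axis clause `|s| = 3/2`, in the Teukolsky–Starobinsky-
coercive region — PROVED (both signs of the spin).** On subextremal Kerr–de Sitter: `Im ω = 0`,
`Im λ̄ = 0`, `FermionicTSCoerciveAbsThreeHalves M a Λ s ω m λ` (`2|s| = 3 ∧ Re ℭ_{3/2}(λ̄) ≥ 0`) ⟹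
every classical radial Teukolsky solution on `(r₊, r_c)` ingoing at `𝓗⁺` and outgoing at `𝓗⁺_c`
vanishes identically. No condition on `ω ≠ 0`, on `m`, on `a`, and no superradiant-window
condition. [cite: CasalsTeixeiradacosta2022, Theorem 3.10 (second bullet, |s| = 3/2) with Costa2019
Proposition 2.21] -/
theorem radial_real_eq_zero_of_fermionicTSCoerciveAbsThreeHalves {M a Λ s : ℝ} {ω : ℂ} {m : ℝ}
    {lam : ℂ} (hsub : IsSubextremal M a Λ) (hω : ω.im = 0)
    (hlamBar : (lambdaBar a Λ s ω m lam).im = 0)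
    (hF : FermionicTSCoerciveAbsThreeHalves M a Λ s ω m lam) {R : ℝ → ℂ}
    (hR : IsRadialTeukolskySolution M a Λ s ω m lam R) (hin : IsIngoingAtEventHorizon M a Λ s ω m R)
    (hout : IsOutgoingAtCosmoHorizon M a Λ ω m R) :
    ∀ r ∈ Ioo (rPlus M a Λ) (rCosmo M a Λ), R r = 0 := by
  rcases (fermionicTSCoerciveAbsThreeHalves_iff M a Λ s ω m lam).1 hF with h | h
  · exact radial_real_eq_zero_of_fermionicTSCoerciveThreeHalves hsub hω hlamBar h hR hin hout
  · exact radial_real_eq_zero_of_fermionicTSCoerciveNegThreeHalves hsub hω hlamBar h hR hin hout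

end Literature.Geometry.Lorentzian.KerrDeSitter

end
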